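import Mathlib.Analysis.Normed.Unbundled.SpectralNorm
import Mathlib.RingTheory.Ideal.Quotient.Operations

/-!
# The closed unit ball of the spectral norm over a complete ultrametric field, and its residue ring

Framing (verbatim for the cell): lottery ticket; floor = certified bounds/negative ranges.

Generic tool file (cell `pub-namedobj`, target (U), seat udg g10): for `Ω` algebraic over a complete nontrivially normed
ultrametric field `K`, Mathlib's spectral norm `spectralNorm K Ω` is a multiplicative ultrametric absolute value,
invariant under `Ω ≃ₐ[K] Ω`.  We package its closed unit ball `ball K Ω` (a subring), the open unit ball
`ballIdeal K Ω` (a prime ideal of it) and the residue ring `Resid K Ω := ball ⧸ ballIdeal` (a domain) with its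
reduction map `resid`.  Used by `MoserLocalReduction` / `MoserFieldPlane` (the 2-adic proof of `χ(ℚ(√3,√11)²) = 4`).
Nothing here is literature: the mathematics is Mathlib's (`spectralNorm`, `spectralMulAlgNorm`, `spectralNorm_eq_of_equiv`).
-/

noncomputable section

namespace Summit.Ventures.DiscreteObjects.UnitDistance.Spectral

variable (K : Type*) [NontriviallyNormedField K]
variable {Ω : Type*} [Field Ω] [Algebra K Ω]

/-- The spectral norm of `x : Ω` over `K` (notation-free wrapper). -/
def spN (x : Ω) : ℝ := spectralNorm K Ω x

/-- Unfolding lemma. -/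
theorem spN_def (x : Ω) : spN K x = spectralNorm K Ω x := rfl

/-- The spectral norm is nonnegative. -/
theorem spN_nonneg (x : Ω) : 0 ≤ spN K x := spectralNorm_nonneg x

/-- `‖0‖ = 0`. -/
theorem spN_zero : spN K (0 : Ω) = 0 := spectralNorm_zero

/-- `‖1‖ = 1`. -/
theorem spN_one : spN K (1 : Ω) = 1 := spectralNorm_one

/-- The spectral norm extends the norm of `K`. -/
theorem spN_algebraMap (k : K) : spN K (algebraMap K Ω k) = ‖k‖ := spectralNorm_extends k

/-- Galois invariance: the spectral norm is invariant under every `K`-algebra automorphism of `Ω`. -/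
theorem spN_aut (σ : Ω ≃ₐ[K] Ω) (x : Ω) : spN K (σ x) = spN K x :=
  (spectralNorm_eq_of_equiv σ x).symm

section Algebraic

variable [Algebra.IsAlgebraic K Ω]

/-- Nonzero elements have positive spectral norm. -/
theorem spN_pos_of_ne_zero {x : Ω} (hx : x ≠ 0) : 0 < spN K x :=
  spectralNorm_zero_lt hx (Algebra.IsAlgebraic.isAlgebraic x)

/-- `‖x‖ = 0 ↔ x = 0`. -/
theorem spN_eq_zero_iff {x : Ω} : spN K x = 0 ↔ x = 0 := by
  refine ⟨fun h => ?_, fun h => by rw [h, spN_zero]⟩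
  by_contra hx
  exact (ne_of_gt (spN_pos_of_ne_zero K hx)) h

variable [IsUltrametricDist K]

/-- `‖-x‖ = ‖x‖`. -/
theorem spN_neg (x : Ω) : spN K (-x) = spN K x :=
  spectralNorm_neg (Algebra.IsAlgebraic.isAlgebraic x)

/-- Ultrametric inequality. -/
theorem spN_add_le (x y : Ω) : spN K (x + y) ≤ max (spN K x) (spN K y) :=
  isNonarchimedean_spectralNorm x y

/-- Ultrametric inequality for differences. -/
theorem spN_sub_le (x y : Ω) : spN K (x - y) ≤ max (spN K x) (spN K y) := by
  rw [sub_eq_add_neg]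
  calc spN K (x + -y) ≤ max (spN K x) (spN K (-y)) := spN_add_le K x (-y)
    _ = max (spN K x) (spN K y) := by rw [spN_neg]

/-- If the norms differ, the norm of the sum is the maximum (ultrametric equality case). -/
theorem spN_add_eq_max_of_ne {x y : Ω} (h : spN K x ≠ spN K y) :
    spN K (x + y) = max (spN K x) (spN K y) := by
  apply le_antisymm (spN_add_le K x y)
  rcases lt_or_gt_of_ne h with hlt | hgt
  · rw [max_eq_right hlt.le]
    have hy : y = (x + y) - x := by ring
    have h2 := spN_sub_le K (x + y) x
    rw [← hy] at h2
    by_contra hc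
    push Not at hc
    rcases le_max_iff.1 h2 with h1 | h1
    · exact absurd h1 (not_le.2 hc)
    · exact absurd h1 (not_le.2 hlt)
  · rw [max_eq_left hgt.le]
    have hx : x = (x + y) - y := by ring
    have h2 := spN_sub_le K (x + y) y
    rw [← hx] at h2
    by_contra hc
    push Not at hc
    rcases le_max_iff.1 h2 with h1 | h1
    · exact absurd h1 (not_le.2 hc)
    · exact absurd h1 (not_le.2 hgt)

end Algebraic

section Complete

variable [CompleteSpace K] [IsUltrametricDist K] [Algebra.IsAlgebraic K Ω]

/-- Over a complete base the spectral norm is multiplicative. -/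
theorem spN_mul (x y : Ω) : spN K (x * y) = spN K x * spN K y := by
  simp only [spN_def, ← spectralMulAlgNorm_def (K := K)]
  exact map_mul _ _ _

/-- `‖x ^ n‖ = ‖x‖ ^ n`. -/
theorem spN_pow (x : Ω) (n : ℕ) : spN K (x ^ n) = spN K x ^ n := by
  induction n with
  | zero => simp [spN_one K]
  | succ n ih => rw [pow_succ, spN_mul, ih, pow_succ]

/-- `‖x⁻¹‖ = ‖x‖⁻¹`. -/
theorem spN_inv (x : Ω) : spN K x⁻¹ = (spN K x)⁻¹ := by
  by_cases hx : x = 0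
  · rw [hx, inv_zero, spN_zero, inv_zero]
  · have h := spN_mul K x x⁻¹
    rw [mul_inv_cancel₀ hx, spN_one] at h
    exact (eq_inv_of_mul_eq_one_right h.symm)

variable (Ω) in
/-- The closed unit ball of the spectral norm: a subring of `Ω`. -/
def ball : Subring Ω where
  carrier := {x | spN K x ≤ 1}
  mul_mem' {x y} hx hy := by
    simp only [Set.mem_setOf_eq] at hx hy ⊢
    rw [spN_mul]
    exact mul_le_one₀ hx (spN_nonneg K y) hy
  one_mem' := by simp only [Set.mem_setOf_eq, spN_one K]; exact le_rfl
  add_mem' {x y} hx hy := by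
    simp only [Set.mem_setOf_eq] at hx hy ⊢
    exact (spN_add_le K x y).trans (max_le hx hy)
  zero_mem' := by simp only [Set.mem_setOf_eq, spN_zero K]; exact zero_le_one
  neg_mem' {x} hx := by
    simp only [Set.mem_setOf_eq] at hx ⊢
    rwa [spN_neg]

/-- Membership in the unit ball. -/
theorem mem_ball_iff {x : Ω} : x ∈ ball K Ω ↔ spN K x ≤ 1 := Iff.rfl

/-- The unit ball is stable under every `K`-automorphism. -/
theorem aut_mem_ball (σ : Ω ≃ₐ[K] Ω) {x : Ω} (hx : x ∈ ball K Ω) : σ x ∈ ball K Ω := by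
  rw [mem_ball_iff, spN_aut]; exact hx

variable (Ω) in
/-- The open unit ball, as an ideal of the closed unit ball. -/
def ballIdeal : Ideal (ball K Ω) where
  carrier := {x | spN K (x : Ω) < 1}
  add_mem' {x y} hx hy := by
    simp only [Set.mem_setOf_eq] at hx hy ⊢
    exact (spN_add_le K (x : Ω) y).trans_lt (max_lt hx hy)
  zero_mem' := by simp only [Set.mem_setOf_eq, ZeroMemClass.coe_zero, spN_zero K]; exact zero_lt_one
  smul_mem' c {x} hx := by
    simp only [Set.mem_setOf_eq, smul_eq_mul, Subring.coe_mul] at hx ⊢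
    rw [spN_mul]
    calc spN K (c : Ω) * spN K (x : Ω) ≤ 1 * spN K (x : Ω) :=
          mul_le_mul_of_nonneg_right c.2 (spN_nonneg K _)
      _ < 1 := by rw [one_mul]; exact hx

/-- Membership in the open unit ball. -/
theorem mem_ballIdeal_iff {x : ball K Ω} : x ∈ ballIdeal K Ω ↔ spN K (x : Ω) < 1 := Iff.rfl

/-- The open unit ball is a prime ideal (the norm is multiplicative). -/
instance ballIdeal_isPrime : (ballIdeal K Ω).IsPrime := by
  refine ⟨?_, ?_⟩
  · rw [Ideal.ne_top_iff_one]
    simp only [mem_ballIdeal_iff, OneMemClass.coe_one, spN_one K]; exact lt_irrefl 1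
  · intro x y hxy
    simp only [mem_ballIdeal_iff, Subring.coe_mul, spN_mul] at hxy ⊢
    by_contra h
    push Not at h
    have : (1 : ℝ) ≤ spN K (x : Ω) * spN K (y : Ω) := by
      calc (1 : ℝ) = 1 * 1 := by ring
        _ ≤ spN K (x : Ω) * spN K (y : Ω) := mul_le_mul h.1 h.2 zero_le_one (spN_nonneg K _)
    exact absurd hxy (not_lt.2 this)

variable (Ω) in
/-- The residue ring of the spectral unit ball (a domain; for a `p`-adic base field, of characteristic `p`). -/
abbrev Resid : Type _ := ball K Ω ⧸ ballIdeal K Ω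

variable (Ω) in
/-- The reduction map. -/
def resid : ball K Ω →+* Resid K Ω := Ideal.Quotient.mk (ballIdeal K Ω)

/-- The residue ring is a domain (the open ball is prime). -/
instance : IsDomain (Resid K Ω) := Ideal.Quotient.isDomain _

/-- `resid x = 0 ↔ ‖x‖ < 1`. -/
theorem resid_eq_zero_iff (x : ball K Ω) : resid K Ω x = 0 ↔ spN K (x : Ω) < 1 := by
  rw [resid, Ideal.Quotient.eq_zero_iff_mem, mem_ballIdeal_iff]

/-- `resid x = resid y ↔ ‖x - y‖ < 1`. -/
theorem resid_eq_iff (x y : ball K Ω) : resid K Ω x = resid K Ω y ↔ spN K ((x : Ω) - y) < 1 := by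
  rw [resid, Ideal.Quotient.eq, mem_ballIdeal_iff, AddSubgroupClass.coe_sub]

/-- Elements of norm exactly `1` have nonzero residue. -/
theorem resid_ne_zero_of_spN_eq_one {x : ball K Ω} (hx : spN K (x : Ω) = 1) : resid K Ω x ≠ 0 := by
  rw [Ne, resid_eq_zero_iff, hx]; exact lt_irrefl 1

/-- `resid` is surjective. -/
theorem resid_surjective : Function.Surjective (resid K Ω) := Ideal.Quotient.mk_surjective

end Complete

end Summit.Ventures.DiscreteObjects.UnitDistance.Spectral
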